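import Summits.NavierStokesRegularity.NavierStokesRegularity.Theorems.QuantisedSymmetryPolyhedralDssProfileExistsStubScarForwardDss
import Mathlib.MeasureTheory.Measure.Haar.NormedSpace
import Mathlib.Analysis.SpecialFunctions.Pow.Integral
import HarnessLib

/-!
# The scar is a critical object — crux stmt-NavierStokesRegularity-1404
  (`QuantisedSymmetry.PolyhedralDssProfileExists`), line polyhedral_cell,
  stub stub_scarCritical (N38)

Registered stub `stub_scarCritical` (`--supports stmt-NavierStokesRegularity-1404`). The
blow-up-time trace ("scar") `V₀` of a witness is continuous off the origin, measurable, vanishes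
at the origin, obeys the critical envelope `|x| |V₀(x)| ≤ C₀`, is `(-1)`-DSS-homogeneous
(`V₀(c x) = c⁻¹ V₀(x)`, `c > 1`) and is not identically zero. This file records that such a field
is a genuinely CRITICAL object: unbounded on every punctured ball at `0`, NOT in `L³(B₁)`, yet in
weak-`L³(ℝ³)` and in `L²_loc`.

Proof sketch.
* Iterated homogeneity: `V₀ (cᵏ x) = (cᵏ)⁻¹ V₀ x` and `V₀ ((cᵏ)⁻¹ x) = cᵏ V₀ x`.
* Unboundedness: from `V₀ x₀ ≠ 0` (so `x₀ ≠ 0`), `‖V₀ ((cᵏ)⁻¹ x₀)‖ = cᵏ ‖V₀ x₀‖ → ∞` while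
  `(cᵏ)⁻¹ x₀ → 0`.
* Not `L³(B₁)` (scale invariance of the `L³` mass): take `x₀` in the punctured unit ball with
  `V₀ x₀ ≠ 0`; by continuity `‖V₀‖ > η := ‖V₀ x₀‖/2` on a ball `B(x₀, δ)`. The zoomed balls
  `Bₖ = (cᵏ)⁻¹ B(x₀, δ)` are pairwise disjoint subsets of `B₁` for `δ` small, `‖V₀‖ > cᵏ η` on
  `Bₖ`, and `|Bₖ| = (cᵏ)⁻³ δ³ |B(0,1)|`, so `∫⁻_{Bₖ} ‖V₀‖³ ≥ (η δ)³ |B(0,1)| > 0` for EVERY `k`;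
  summing over `k` gives `∫⁻_{B₁} ‖V₀‖³ = ∞`.
* Weak-`L³`: the helper `scarForwardDss_memWeakLp` of stub N32 (superlevel sets lie in balls of
  radius `C₀/σ`).
* `L²_loc`: `‖V₀ x‖² ≤ C₀² ‖x‖⁻²` and `‖x‖⁻²` is integrable on balls of `ℝ³`
  (`integrableOn_ball_of_norm_le_rpow`).
-/

noncomputable section

-- the summit namespace `…NavierStokesRegularity.NavierStokesRegularity…` is the tree convention (D-0017)
set_option linter.dupNamespace false

namespace Summit.NavierStokesRegularity.NavierStokesRegularity.Theorems.PolyhedralDssProfileExists.PolyhedralCell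

open MeasureTheory Set Function Filter Topology
open Literature.Analysis Literature.Analysis.FluidPDE
open scoped ENNReal

/-! ### Iterated homogeneity -/

/-- Iterating `V₀ (c • x) = c⁻¹ • V₀ x`: `V₀ (cᵏ • x) = (cᵏ)⁻¹ • V₀ x`. [folklore] -/
theorem scarCritical_hom_pow {V₀ : EuclideanSpace ℝ (Fin 3) → EuclideanSpace ℝ (Fin 3)} {c : ℝ}
    (hhom : ∀ x, V₀ (c • x) = c⁻¹ • V₀ x) (k : ℕ) (x : EuclideanSpace ℝ (Fin 3)) :
    V₀ (c ^ k • x) = (c ^ k)⁻¹ • V₀ x := by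
  induction k generalizing x with
  | zero => simp
  | succ k ih => rw [pow_succ', mul_smul, hhom, ih, smul_smul, mul_inv]

/-- Downward homogeneity: `V₀ ((cᵏ)⁻¹ • x) = cᵏ • V₀ x` (`c ≠ 0`). [folklore] -/
theorem scarCritical_hom_down {V₀ : EuclideanSpace ℝ (Fin 3) → EuclideanSpace ℝ (Fin 3)} {c : ℝ}
    (hc : c ≠ 0) (hhom : ∀ x, V₀ (c • x) = c⁻¹ • V₀ x) (k : ℕ) (x : EuclideanSpace ℝ (Fin 3)) :
    V₀ ((c ^ k)⁻¹ • x) = c ^ k • V₀ x := by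
  have h1 := scarCritical_hom_pow hhom k ((c ^ k)⁻¹ • x)
  rw [smul_smul, mul_inv_cancel₀ (pow_ne_zero k hc), one_smul] at h1
  rw [h1, smul_smul, mul_inv_cancel₀ (pow_ne_zero k hc), one_smul]

/-- Norm form of upward homogeneity: `‖V₀ (cᵏ • x)‖ = (cᵏ)⁻¹ ‖V₀ x‖` (`c > 0`). [folklore] -/
theorem scarCritical_norm_up {V₀ : EuclideanSpace ℝ (Fin 3) → EuclideanSpace ℝ (Fin 3)} {c : ℝ}
    (hc : 0 < c) (hhom : ∀ x, V₀ (c • x) = c⁻¹ • V₀ x) (k : ℕ) (x : EuclideanSpace ℝ (Fin 3)) :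
    ‖V₀ (c ^ k • x)‖ = (c ^ k)⁻¹ * ‖V₀ x‖ := by
  rw [scarCritical_hom_pow hhom, norm_smul, norm_inv, Real.norm_of_nonneg (pow_nonneg hc.le k)]

/-- Norm form of downward homogeneity: `‖V₀ ((cᵏ)⁻¹ • x)‖ = cᵏ ‖V₀ x‖` (`c > 0`). [folklore] -/
theorem scarCritical_norm_down {V₀ : EuclideanSpace ℝ (Fin 3) → EuclideanSpace ℝ (Fin 3)} {c : ℝ}
    (hc : 0 < c) (hhom : ∀ x, V₀ (c • x) = c⁻¹ • V₀ x) (k : ℕ) (x : EuclideanSpace ℝ (Fin 3)) :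
    ‖V₀ ((c ^ k)⁻¹ • x)‖ = c ^ k * ‖V₀ x‖ := by
  rw [scarCritical_hom_down hc.ne' hhom, norm_smul, Real.norm_of_nonneg (pow_nonneg hc.le k)]

/-! ### Unboundedness at the origin -/

/-- **The scar is unbounded on every punctured ball at the origin.** If `V₀ 0 = 0`,
`V₀ (c • x) = c⁻¹ • V₀ x` (`c > 1`) and `V₀ x₀ ≠ 0`, then `x₀ ≠ 0` and
`‖V₀ ((cᵏ)⁻¹ • x₀)‖ = cᵏ ‖V₀ x₀‖` exceeds any `M` while `(cᵏ)⁻¹ • x₀` enters the unit ball.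
[folklore] -/
theorem scarCritical_unbounded {V₀ : EuclideanSpace ℝ (Fin 3) → EuclideanSpace ℝ (Fin 3)} {c : ℝ}
    (hc : 1 < c) (hhom : ∀ x, V₀ (c • x) = c⁻¹ • V₀ x) (h0 : V₀ 0 = 0)
    (hne : ∃ x, V₀ x ≠ 0) (M : ℝ) :
    ∃ x : EuclideanSpace ℝ (Fin 3), x ≠ 0 ∧ ‖x‖ < 1 ∧ M < ‖V₀ x‖ := by
  obtain ⟨x₀, hx₀⟩ := hne
  have hc0 : 0 < c := one_pos.trans hc
  have hx₀0 : x₀ ≠ 0 := fun h => hx₀ (by rw [h, h0])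
  have hV : 0 < ‖V₀ x₀‖ := norm_pos_iff.2 hx₀
  obtain ⟨k, hk⟩ := pow_unbounded_of_one_lt (max (M / ‖V₀ x₀‖) ‖x₀‖) hc
  have hk1 : M / ‖V₀ x₀‖ < c ^ k := (le_max_left _ _).trans_lt hk
  have hk2 : ‖x₀‖ < c ^ k := (le_max_right _ _).trans_lt hk
  refine ⟨(c ^ k)⁻¹ • x₀, smul_ne_zero (inv_ne_zero (pow_ne_zero k hc0.ne')) hx₀0, ?_, ?_⟩
  · rw [norm_smul, norm_inv, Real.norm_of_nonneg (pow_nonneg hc0.le k),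
      inv_mul_lt_iff₀ (pow_pos hc0 k), mul_one]
    exact hk2
  · rw [scarCritical_norm_down hc0 hhom]
    exact (div_lt_iff₀ hV).1 hk1

/-! ### The scar is not in `L³(B₁)` -/

/-- **Continuity keeps the scar away from zero near a point where it is nonzero**: if `V₀` is
continuous off the origin, `x₀ ≠ 0` and `V₀ x₀ ≠ 0`, then `‖V₀‖ > ‖V₀ x₀‖ / 2` on a ball about
`x₀`. [folklore] -/
theorem scarCritical_lower_near {V₀ : EuclideanSpace ℝ (Fin 3) → EuclideanSpace ℝ (Fin 3)}
    (hcont : ContinuousOn V₀ {x | x ≠ 0}) {x₀ : EuclideanSpace ℝ (Fin 3)} (hx₀ : x₀ ≠ 0)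
    (hV : 0 < ‖V₀ x₀‖) :
    ∃ δ₁ > 0, ∀ y, dist y x₀ < δ₁ → ‖V₀ x₀‖ / 2 < ‖V₀ y‖ := by
  have hca : ContinuousAt V₀ x₀ := hcont.continuousAt (isOpen_ne.mem_nhds hx₀)
  obtain ⟨δ₁, hδ₁, h⟩ := Metric.continuousAt_iff.1 hca (‖V₀ x₀‖ / 2) (half_pos hV)
  refine ⟨δ₁, hδ₁, fun y hy => ?_⟩
  have h1 : dist (V₀ y) (V₀ x₀) < ‖V₀ x₀‖ / 2 := h hy
  rw [dist_comm, dist_eq_norm] at h1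
  have h2 := norm_sub_norm_le (V₀ x₀) (V₀ y)
  linarith

/-- Points of the ball `B(ρ x₀, ρ δ)` (`ρ > 0`) have norm in `(ρ (‖x₀‖ - δ), ρ (‖x₀‖ + δ))`.
[folklore] -/
theorem scarCritical_norm_mem_ball {x₀ y : EuclideanSpace ℝ (Fin 3)} {ρ δ : ℝ} (hρ : 0 < ρ)
    (hy : y ∈ Metric.ball (ρ • x₀) (ρ * δ)) :
    ρ * (‖x₀‖ - δ) < ‖y‖ ∧ ‖y‖ < ρ * (‖x₀‖ + δ) := by
  rw [Metric.mem_ball, dist_eq_norm] at hy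
  have hn : ‖ρ • x₀‖ = ρ * ‖x₀‖ := by rw [norm_smul, Real.norm_of_nonneg hρ.le]
  have h1 := norm_sub_norm_le (ρ • x₀) y
  have h2 := norm_sub_norm_le y (ρ • x₀)
  rw [hn, norm_sub_rev (ρ • x₀) y] at h1
  rw [hn] at h2
  constructor
  · rw [mul_sub]; linarith
  · rw [mul_add]; linarith

/-- **Scale-invariant `L³` mass of the zoomed balls.** If `‖V₀‖ > η ≥ 0` on `B(x₀, δ₁)` and
`V₀ (c • x) = c⁻¹ • V₀ x` (`c > 0`), then on `Bₖ = B((cᵏ)⁻¹ x₀, (cᵏ)⁻¹ δ)` (`0 ≤ δ ≤ δ₁`) one has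
`‖V₀‖ > cᵏ η` (zoom up by `cᵏ` into `B(x₀, δ)`), so
`∫⁻_{Bₖ} ‖V₀‖³ ≥ (cᵏ η)³ |Bₖ| = (cᵏ η)³ ((cᵏ)⁻¹ δ)³ |B(0,1)| = (η δ)³ |B(0,1)|`, a bound independent
of `k`. [folklore] -/
theorem scarCritical_ball_lintegral_le {V₀ : EuclideanSpace ℝ (Fin 3) → EuclideanSpace ℝ (Fin 3)}
    {c : ℝ} (hc : 0 < c) (hhom : ∀ x, V₀ (c • x) = c⁻¹ • V₀ x) {x₀ : EuclideanSpace ℝ (Fin 3)}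
    {η δ₁ δ : ℝ} (hη : 0 ≤ η) (hδ : 0 ≤ δ) (hδδ₁ : δ ≤ δ₁)
    (hlow : ∀ y, dist y x₀ < δ₁ → η < ‖V₀ y‖) (k : ℕ) :
    ENNReal.ofReal ((η * δ) ^ 3) * volume (Metric.ball (0 : EuclideanSpace ℝ (Fin 3)) 1) ≤
      ∫⁻ y in Metric.ball ((c ^ k)⁻¹ • x₀) ((c ^ k)⁻¹ * δ), ‖‖V₀ y‖ ^ 3‖ₑ := by
  have hck : 0 < c ^ k := pow_pos hc k
  -- the pointwise lower bound on the zoomed ball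
  have hpt : ∀ y ∈ Metric.ball ((c ^ k)⁻¹ • x₀) ((c ^ k)⁻¹ * δ), c ^ k * η < ‖V₀ y‖ := by
    intro y hy
    rw [Metric.mem_ball, dist_eq_norm] at hy
    have hdist : dist (c ^ k • y) x₀ < δ₁ := by
      rw [dist_eq_norm]
      have : c ^ k • y - x₀ = c ^ k • (y - (c ^ k)⁻¹ • x₀) := by
        rw [smul_sub, smul_smul, mul_inv_cancel₀ hck.ne', one_smul]
      rw [this, norm_smul, Real.norm_of_nonneg hck.le]
      calc c ^ k * ‖y - (c ^ k)⁻¹ • x₀‖ < c ^ k * ((c ^ k)⁻¹ * δ) :=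
            mul_lt_mul_of_pos_left hy hck
        _ = δ := by rw [← mul_assoc, mul_inv_cancel₀ hck.ne', one_mul]
        _ ≤ δ₁ := hδδ₁
    have h1 := hlow _ hdist
    rw [scarCritical_norm_up hc hhom] at h1
    exact (lt_inv_mul_iff₀ hck).1 h1
  -- the Jacobian `(cᵏ)⁻³` cancels the growth `c³ᵏ` of `‖V₀‖³`
  have hreal : (c ^ k * η) ^ 3 * ((c ^ k)⁻¹ * δ) ^ 3 = (η * δ) ^ 3 := by
    rw [show (c ^ k * η) ^ 3 * ((c ^ k)⁻¹ * δ) ^ 3 = (c ^ k * (c ^ k)⁻¹) ^ 3 * (η * δ) ^ 3 by ring,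
      mul_inv_cancel₀ hck.ne', one_pow, one_mul]
  calc ENNReal.ofReal ((η * δ) ^ 3) * volume (Metric.ball (0 : EuclideanSpace ℝ (Fin 3)) 1)
      = ∫⁻ _ in Metric.ball ((c ^ k)⁻¹ • x₀) ((c ^ k)⁻¹ * δ), ENNReal.ofReal ((c ^ k * η) ^ 3) := by
        rw [setLIntegral_const,
          Measure.addHaar_ball volume _ (by positivity : (0 : ℝ) ≤ (c ^ k)⁻¹ * δ),
          finrank_euclideanSpace_fin, ← mul_assoc, ← ENNReal.ofReal_mul (by positivity), hreal]
    _ ≤ ∫⁻ y in Metric.ball ((c ^ k)⁻¹ • x₀) ((c ^ k)⁻¹ * δ), ‖‖V₀ y‖ ^ 3‖ₑ :=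
        setLIntegral_mono' measurableSet_ball fun y hy => by
          rw [Real.enorm_eq_ofReal (by positivity)]
          exact ENNReal.ofReal_le_ofReal (pow_le_pow_left₀ (by positivity) (hpt y hy).le 3)

/-- **The zoomed balls are pairwise disjoint** once `δ (c + 1) ≤ (c - 1) ‖x₀‖` (`c > 1`): the
`k`-th ball lies in the shell `(cᵏ)⁻¹ (‖x₀‖ - δ) < ‖y‖ < (cᵏ)⁻¹ (‖x₀‖ + δ)`, and for `m < n`
`(cⁿ)⁻¹ (‖x₀‖ + δ) ≤ c⁻¹ (cᵐ)⁻¹ (‖x₀‖ + δ) ≤ (cᵐ)⁻¹ (‖x₀‖ - δ)`. [folklore] -/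
theorem scarCritical_balls_disjoint {c : ℝ} (hc : 1 < c) {x₀ : EuclideanSpace ℝ (Fin 3)} {δ : ℝ}
    (hδ : 0 ≤ δ) (hδc : δ * (c + 1) ≤ (c - 1) * ‖x₀‖) :
    Pairwise (Disjoint on fun k : ℕ => Metric.ball ((c ^ k)⁻¹ • x₀) ((c ^ k)⁻¹ * δ)) := by
  have hc0 : 0 < c := one_pos.trans hc
  rw [pairwise_disjoint_on]
  intro m n hmn
  refine Set.disjoint_left.2 fun y hym hyn => ?_
  have hm := (scarCritical_norm_mem_ball (inv_pos.2 (pow_pos hc0 m)) hym).1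
  have hn := (scarCritical_norm_mem_ball (inv_pos.2 (pow_pos hc0 n)) hyn).2
  -- `(cⁿ)⁻¹ ≤ c⁻¹ (cᵐ)⁻¹`
  have hr : (c ^ n)⁻¹ ≤ c⁻¹ * (c ^ m)⁻¹ := by
    rw [← mul_inv, ← pow_succ']
    exact inv_anti₀ (pow_pos hc0 _) (pow_le_pow_right₀ hc.le (Nat.succ_le_of_lt hmn))
  have hkey : c⁻¹ * (‖x₀‖ + δ) ≤ ‖x₀‖ - δ := by
    rw [inv_mul_le_iff₀ hc0]
    linarith
  have hpos : 0 ≤ ‖x₀‖ + δ := by positivity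
  have : (c ^ n)⁻¹ * (‖x₀‖ + δ) ≤ (c ^ m)⁻¹ * (‖x₀‖ - δ) :=
    calc (c ^ n)⁻¹ * (‖x₀‖ + δ) ≤ c⁻¹ * (c ^ m)⁻¹ * (‖x₀‖ + δ) :=
          mul_le_mul_of_nonneg_right hr hpos
      _ = (c ^ m)⁻¹ * (c⁻¹ * (‖x₀‖ + δ)) := by ring
      _ ≤ (c ^ m)⁻¹ * (‖x₀‖ - δ) :=
          mul_le_mul_of_nonneg_left hkey (inv_nonneg.2 (pow_nonneg hc0.le m))
  linarith

/-- The zoomed balls lie in the unit ball once `0 ≤ δ ≤ 1 - ‖x₀‖` (`c ≥ 1`). [folklore] -/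
theorem scarCritical_ball_subset {c : ℝ} (hc : 1 ≤ c) {x₀ : EuclideanSpace ℝ (Fin 3)} {δ : ℝ}
    (hδ : 0 ≤ δ) (hδ1 : δ ≤ 1 - ‖x₀‖) (k : ℕ) :
    Metric.ball ((c ^ k)⁻¹ • x₀) ((c ^ k)⁻¹ * δ) ⊆ Metric.ball 0 1 := fun y hy => by
  have hc0 : 0 < c := one_pos.trans_le hc
  have h := (scarCritical_norm_mem_ball (inv_pos.2 (pow_pos hc0 k)) hy).2
  rw [mem_ball_zero_iff]
  have h1 : (c ^ k)⁻¹ ≤ 1 := inv_le_one_of_one_le₀ (one_le_pow₀ hc)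
  have hpos : 0 ≤ ‖x₀‖ + δ := by positivity
  calc ‖y‖ < (c ^ k)⁻¹ * (‖x₀‖ + δ) := h
    _ ≤ 1 * (‖x₀‖ + δ) := mul_le_mul_of_nonneg_right h1 hpos
    _ ≤ 1 := by linarith

/-- **The scar is not in `L³(B₁)`.** If `V₀` is continuous off the origin, `V₀ 0 = 0`,
`V₀ (c • x) = c⁻¹ • V₀ x` (`c > 1`) and `V₀` is not identically zero, then `‖V₀‖³` is not
integrable on the unit ball: infinitely many pairwise disjoint zoomed balls `Bₖ ⊆ B₁` each carry
`L³` mass at least `(η δ)³ |B(0,1)| > 0`. [folklore] -/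
theorem scarCritical_not_integrableOn {V₀ : EuclideanSpace ℝ (Fin 3) → EuclideanSpace ℝ (Fin 3)}
    {c : ℝ} (hc : 1 < c) (hcont : ContinuousOn V₀ {x | x ≠ 0})
    (hhom : ∀ x, V₀ (c • x) = c⁻¹ • V₀ x) (h0 : V₀ 0 = 0) (hne : ∃ x, V₀ x ≠ 0) :
    ¬ IntegrableOn (fun x => ‖V₀ x‖ ^ 3) (Metric.ball (0 : EuclideanSpace ℝ (Fin 3)) 1) volume := by
  intro hint
  have hc0 : 0 < c := one_pos.trans hc
  -- a point of the punctured unit ball where the scar is nonzero, and a ball where it stays so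
  obtain ⟨x₀, hx₀, hx₀1, hV⟩ := scarCritical_unbounded hc hhom h0 hne 0
  have hxn : 0 < ‖x₀‖ := norm_pos_iff.2 hx₀
  obtain ⟨δ₁, hδ₁, hlow⟩ := scarCritical_lower_near hcont hx₀ hV
  -- the radius of the mother ball `B(x₀, δ)`
  obtain ⟨δ, hδpos, hδδ₁, hδ1, hδc⟩ :
      ∃ δ : ℝ, 0 < δ ∧ δ ≤ δ₁ ∧ δ ≤ 1 - ‖x₀‖ ∧ δ * (c + 1) ≤ (c - 1) * ‖x₀‖ := by
    refine ⟨min δ₁ (min (1 - ‖x₀‖) ((c - 1) * ‖x₀‖ / (c + 1))),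
      lt_min hδ₁ (lt_min (by linarith) (div_pos (mul_pos (by linarith) hxn) (by linarith))),
      min_le_left _ _, (min_le_right _ _).trans (min_le_left _ _), ?_⟩
    exact (le_div_iff₀ (by linarith)).1 ((min_le_right _ _).trans (min_le_right _ _))
  -- the common lower bound of the `L³` masses of the zoomed balls
  have hK0 : ENNReal.ofReal ((‖V₀ x₀‖ / 2 * δ) ^ 3) *
      volume (Metric.ball (0 : EuclideanSpace ℝ (Fin 3)) 1) ≠ 0 :=
    mul_ne_zero (ENNReal.ofReal_pos.2 (by positivity)).ne' (Metric.measure_ball_pos volume _ one_pos).ne'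
  have hle : ∑' _ : ℕ, ENNReal.ofReal ((‖V₀ x₀‖ / 2 * δ) ^ 3) *
        volume (Metric.ball (0 : EuclideanSpace ℝ (Fin 3)) 1) ≤
      ∫⁻ y in Metric.ball (0 : EuclideanSpace ℝ (Fin 3)) 1, ‖‖V₀ y‖ ^ 3‖ₑ :=
    calc ∑' _ : ℕ, ENNReal.ofReal ((‖V₀ x₀‖ / 2 * δ) ^ 3) *
            volume (Metric.ball (0 : EuclideanSpace ℝ (Fin 3)) 1)
        ≤ ∑' k : ℕ, ∫⁻ y in Metric.ball ((c ^ k)⁻¹ • x₀) ((c ^ k)⁻¹ * δ), ‖‖V₀ y‖ ^ 3‖ₑ :=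
          ENNReal.tsum_le_tsum fun k =>
            scarCritical_ball_lintegral_le hc0 hhom (half_pos hV).le hδpos.le hδδ₁ hlow k
      _ = ∫⁻ y in ⋃ k : ℕ, Metric.ball ((c ^ k)⁻¹ • x₀) ((c ^ k)⁻¹ * δ), ‖‖V₀ y‖ ^ 3‖ₑ :=
          (lintegral_iUnion (fun _ => measurableSet_ball)
            (scarCritical_balls_disjoint hc hδpos.le hδc) _).symm
      _ ≤ ∫⁻ y in Metric.ball (0 : EuclideanSpace ℝ (Fin 3)) 1, ‖‖V₀ y‖ ^ 3‖ₑ :=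
          lintegral_mono_set (iUnion_subset fun k => scarCritical_ball_subset hc.le hδpos.le hδ1 k)
  have hfin := hint.hasFiniteIntegral
  rw [hasFiniteIntegral_iff_enorm] at hfin
  rw [ENNReal.tsum_const_eq_top_of_ne_zero hK0, top_le_iff] at hle
  exact hfin.ne hle

/-! ### The scar is in `L²_loc` -/

/-- **The scar is in `L²_loc`.** A measurable field with `V₀ 0 = 0` under the critical envelope
`‖x‖ ‖V₀ x‖ ≤ C₀` satisfies `‖V₀ x‖² ≤ C₀² ‖x‖⁻²`, and `‖x‖⁻²` is integrable on balls of `ℝ³`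
(`2 < 3`). [folklore] -/
theorem scarCritical_sq_integrableOn {V₀ : EuclideanSpace ℝ (Fin 3) → EuclideanSpace ℝ (Fin 3)}
    {C₀ : ℝ} (hmeas : AEStronglyMeasurable V₀ volume) (h0 : V₀ 0 = 0)
    (henv : ∀ x, ‖x‖ * ‖V₀ x‖ ≤ C₀) (r : ℝ) :
    IntegrableOn (fun x => ‖V₀ x‖ ^ 2) (Metric.ball (0 : EuclideanSpace ℝ (Fin 3)) r) volume := by
  refine integrableOn_ball_of_norm_le_rpow (by rw [finrank_euclideanSpace_fin]; norm_num)
    (C := C₀ ^ 2) (α := 2) (by rw [finrank_euclideanSpace_fin]; norm_num)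
    (Eventually.of_forall fun x => ?_) ((continuous_norm.pow 2).comp_aestronglyMeasurable hmeas)
  rw [norm_pow, norm_norm]
  by_cases hx : x = 0
  · rw [hx, h0, norm_zero, Real.zero_rpow (by norm_num), mul_zero, zero_pow two_ne_zero]
  · have hxn : 0 < ‖x‖ := norm_pos_iff.2 hx
    have h1 : ‖V₀ x‖ ≤ C₀ / ‖x‖ := by
      rw [le_div_iff₀ hxn, mul_comm]
      exact henv x
    calc ‖V₀ x‖ ^ 2 ≤ (C₀ / ‖x‖) ^ 2 := pow_le_pow_left₀ (norm_nonneg _) h1 2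
      _ = C₀ ^ 2 * ‖x‖ ^ (-(2 : ℝ)) := by
          rw [Real.rpow_neg (norm_nonneg x), Real.rpow_two, div_pow, div_eq_mul_inv]

/-! ### The stub -/

/-- **Stub N38: the scar is a genuinely CRITICAL object — unbounded at the origin, not in `L³`
near it, yet in weak-`L³` and in `L²_loc`.** Let `V₀` be continuous off the origin,
a.e.-strongly measurable, with `V₀ 0 = 0`, `‖x‖ ‖V₀ x‖ ≤ C₀`, DSS-homogeneous
`V₀ (c x) = c⁻¹ V₀ x` (`c > 1`) and not identically zero. Then `V₀` is unbounded on every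
punctured ball at `0`; `‖V₀‖³` is NOT integrable on `B₁` (the `L³` masses of the zoomed copies
`(cᵏ)⁻¹ B(x₀, δ) ⊆ B₁` of a ball where `‖V₀‖ > η > 0` are all at least `(η δ)³ |B(0,1)|` — `L³(ℝ³)`
is scale invariant — and there are infinitely many of them, pairwise disjoint); but
`V₀ ∈ L^{3,∞}` (`{σ < |V₀|} ⊆ B̄_{C₀/σ}`, helper `scarForwardDss_memWeakLp` of stub N32) and
`‖V₀‖² ∈ L¹(B_r)` for every `r` (envelope `C₀² ‖x‖⁻²`). [folklore] -/
theorem stub_scarCritical :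
    ∀ (V₀ : EuclideanSpace ℝ (Fin 3) → EuclideanSpace ℝ (Fin 3)) (C₀ c : ℝ),
      ContinuousOn V₀ {x | x ≠ 0} → AEStronglyMeasurable V₀ volume → V₀ 0 = 0 →
      (∀ x, ‖x‖ * ‖V₀ x‖ ≤ C₀) → 1 < c → (∀ x, V₀ (c • x) = c⁻¹ • V₀ x) → (∃ x, V₀ x ≠ 0) →
      (∀ M : ℝ, ∃ x : EuclideanSpace ℝ (Fin 3), x ≠ 0 ∧ ‖x‖ < 1 ∧ M < ‖V₀ x‖) ∧
      ¬ IntegrableOn (fun x => ‖V₀ x‖ ^ 3) (Metric.ball (0 : EuclideanSpace ℝ (Fin 3)) 1) volume ∧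
      Literature.Analysis.FunctionSpaces.MemWeakLp V₀ 3 volume ∧
      (∀ r : ℝ, 0 < r → IntegrableOn (fun x => ‖V₀ x‖ ^ 2) (Metric.ball (0 : EuclideanSpace ℝ (Fin 3)) r) volume) := by
  intro V₀ C₀ c hcont hmeas h0 henv hc hhom hne
  exact ⟨scarCritical_unbounded hc hhom h0 hne, scarCritical_not_integrableOn hc hcont hhom h0 hne,
    scarForwardDss_memWeakLp hmeas henv, fun r _ => scarCritical_sq_integrableOn hmeas h0 henv r⟩

end Summit.NavierStokesRegularity.NavierStokesRegularity.Theorems.PolyhedralDssProfileExists.PolyhedralCell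

end
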